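import Mathlib
import Summits.Ventures.HodgeRepro.Tier4.Line1.RTFSetting
import Summits.Ventures.HodgeRepro.Tier4.Line1.KernelSupportFinite

/-!
# Tier4/Line1/IsolatingNbhd — LINE L1, J2.d′-gen `exists_isolating_nbhd_of_hasse` (an isolating neighbourhood from
the Hasse principle)

Blind re-derivation cell `pub-hodge-repro`, Tier 4 «prove the step» (README §9–§10), seat t4-L1-p1 (prover, gen 0),
LINE L1 (the RTF line; the generic half of the arithmetic half of the heart, t4-plan-1 S12277 (i), taken by load
balance S12426).  The docstring and statement are restated BYTE-IDENTICALLY from Skeleton-v0.13.lean L344–L355 inside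
`namespace Summit.Ventures.HodgeRepro.Tier4.Line1.RTF.Setting` with `variable (S : Setting G)`.  Imports: the generic
layer `RTFSetting` and `KernelSupportFinite` (for `finite_of_subset_compact`).  No `sorry`; axioms = the trio.

THE MATHEMATICS (the docstring's plan).  `V` a compact neighbourhood of `γ₀` (`G` locally compact).  The rational
`γ` with `(closure DT)⁻¹ γ (closure DT') ∩ V ≠ ∅` lie in the compact `closure DT · V · (closure DT')⁻¹`, so they are
finitely many (`G(k)` closed and discrete — `finite_of_subset_compact`).  For each of them with `[γ] ≠ [γ₀]` the piece
`K_γ := (closure DT)⁻¹ γ (closure DT')` is compact (a continuous image) and misses `γ₀`: a point `t⁻¹ γ t' = γ₀`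
would make `γ` adelically conjugate to `γ₀`, hence `[γ] = [γ₀]` by `hH`.  `U := interior V \ ⋃ K_γ` is open (a finite
union of compact sets is closed in the Hausdorff `G`), contains `γ₀`, and if `t⁻¹ γ t' ∈ U` with `t ∈ closure DT`,
`t' ∈ closure DT'` then `γ` is one of the finitely many and `t⁻¹ γ t' ∉ K_γ` forces `[γ] = [γ₀]`.

Nothing here says anything about the status of the Hodge conjecture for CM abelian varieties, which is NOT proved
(HC_CM is NOT proved by anyone in this repository).
-/

set_option autoImplicit false

noncomputable section

namespace Summit.Ventures.HodgeRepro.Tier4.Line1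

open MeasureTheory Topology

namespace RTF

variable {G : Type} [Group G] [TopologicalSpace G] [IsTopologicalGroup G] [MeasurableSpace G]
  [BorelSpace G]

namespace Setting

variable (S : Setting G)

omit [BorelSpace G] in
/-- (J2.d′-gen, prover-facing, M — v0.11, the generic half of the arithmetic half): **an isolating neighbourhood from the
Hasse principle** — if every rational `γ` adelically `T × T′`-conjugate to `γ₀` lies in `[γ₀]`, then some open `U ∋ γ₀`
meets, on `closure DT × closure DT′`, no rational double coset but `[γ₀]`.  Proof plan: `V` a compact neighbourhood of
`γ₀`; a rational `γ` with `(closure DT)⁻¹ γ (closure DT′) ∩ V ≠ ∅` lies in the compact `closure DT · V · (closure DT′)⁻¹`,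
so these `γ` are finitely many (`discrete`, `closed`: p3's `finite_rational_of_isCompact`); for each of them with
`[γ] ≠ [γ₀]` the piece `K_γ = (closure DT)⁻¹ γ (closure DT′)` is compact and misses `γ₀` (`hH`); take
`U := interior V \ ⋃ K_γ` (a finite union of compact sets is closed in the Hausdorff `G`). -/
theorem exists_isolating_nbhd_of_hasse [LocallyCompactSpace G] [T2Space G] (γ₀ : S.Gk)
    (hH : ∀ γ : S.Gk, (∃ t ∈ S.T, ∃ t' ∈ S.T', t⁻¹ * γ * t' = γ₀) → S.orbitOf γ = S.orbitOf γ₀) :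
    ∃ U : Set G, IsOpen U ∧ (γ₀ : G) ∈ U ∧
      ∀ t ∈ closure S.DT, ∀ t' ∈ closure S.DT', ∀ γ : S.Gk,
        (t : G)⁻¹ * γ * t' ∈ U → S.orbitOf γ = S.orbitOf γ₀ := by
  -- a compact neighbourhood `V` of `γ₀`
  obtain ⟨V, hVc, hVn⟩ := exists_compact_mem_nhds (γ₀ : G)
  -- the finitely many rational points whose piece meets `V`
  have hK : IsCompact ((fun p : S.T × G × S.T' => (p.1 : G) * p.2.1 * (p.2.2 : G)⁻¹) ''
      (closure S.DT ×ˢ V ×ˢ closure S.DT')) :=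
    (S.compT.prod (hVc.prod S.compT')).image
      (((continuous_subtype_val.comp continuous_fst).mul
        (continuous_fst.comp continuous_snd)).mul
        ((continuous_subtype_val.comp (continuous_snd.comp continuous_snd)).inv))
  have hΓ : {γ : S.Gk | ∃ t ∈ closure S.DT, ∃ t' ∈ closure S.DT', (t : G)⁻¹ * γ * t' ∈ V}.Finite := by
    refine S.finite_of_subset_compact hK ?_
    rintro γ ⟨t, ht, t', ht', hv⟩
    refine ⟨(t, (t : G)⁻¹ * γ * t', t'), ⟨ht, hv, ht'⟩, ?_⟩
    show (t : G) * ((t : G)⁻¹ * γ * t') * (t' : G)⁻¹ = γ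
    group
  -- the bad ones: those in another rational double coset
  set B : Set S.Gk := {γ | (∃ t ∈ closure S.DT, ∃ t' ∈ closure S.DT', (t : G)⁻¹ * γ * t' ∈ V) ∧
    S.orbitOf γ ≠ S.orbitOf γ₀} with hB
  have hBfin : B.Finite := hΓ.subset fun γ hγ => hγ.1
  -- their compact pieces
  set Kp : S.Gk → Set G := fun γ =>
    (fun p : S.T × S.T' => (p.1 : G)⁻¹ * γ * (p.2 : G)) '' (closure S.DT ×ˢ closure S.DT') with hKp
  have hKpc : ∀ γ, IsCompact (Kp γ) := fun γ =>
    (S.compT.prod S.compT').image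
      (((continuous_subtype_val.comp continuous_fst).inv.mul continuous_const).mul
        (continuous_subtype_val.comp continuous_snd))
  have hKpclosed : IsClosed (⋃ γ ∈ B, Kp γ) :=
    hBfin.isClosed_biUnion fun γ _ => (hKpc γ).isClosed
  -- `γ₀` is in no bad piece (`hH`)
  have hγ₀ : (γ₀ : G) ∉ ⋃ γ ∈ B, Kp γ := by
    intro hmem
    rw [Set.mem_iUnion₂] at hmem
    obtain ⟨γ, hγB, hγ₀K⟩ := hmem
    obtain ⟨⟨t, t'⟩, -, hpt⟩ := hγ₀K
    exact hγB.2 (hH γ ⟨t, t.2, t', t'.2, hpt⟩)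
  refine ⟨interior V \ ⋃ γ ∈ B, Kp γ, isOpen_interior.sdiff hKpclosed,
    ⟨mem_interior_iff_mem_nhds.mpr hVn, hγ₀⟩, ?_⟩
  intro t ht t' ht' γ hγU
  by_contra hne
  have hγB : γ ∈ B := ⟨⟨t, ht, t', ht', interior_subset hγU.1⟩, hne⟩
  apply hγU.2
  rw [Set.mem_iUnion₂]
  exact ⟨γ, hγB, ⟨(t, t'), ⟨ht, ht'⟩, rfl⟩⟩

end Setting

end RTF

end Summit.Ventures.HodgeRepro.Tier4.Line1
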